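import Literature.Analysis.UnboundedOperators.HeatKernelGaussianIBP
import Mathlib.Analysis.Calculus.LineDeriv.IntegrationByParts
import Mathlib.Analysis.InnerProductSpace.Dual
import Mathlib.MeasureTheory.Integral.Bochner.ContinuousLinearMap
import HarnessLib

/-!
# The reverse Poincaré inequality of the heat semigroup (caloric Bernstein estimate)

Analysis/UnboundedOperators file (all results proved, no definitions, no named facts). For a
finite-dimensional real inner product space `E`, the Gauss–Weierstrass kernel `G_t = heatKernel t`
(`0 < t`, a probability density with covariance `2t·Id`) and a bounded continuous `f : E → ℝ`:

`(e^{tΔ}f)(x)² + 2t ‖∇(e^{tΔ}f)(x)‖² ≤ e^{tΔ}(f²)(x)`  (`sq_heatExtension_add_le_heatExtension_sq`),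

the **reverse (local) Poincaré inequality** of the Euclidean heat semigroup with its sharp
constant (Bakry–Gentil–Ledoux, Thm. 4.7.2 (ii) at curvature `ρ = 0`: `P_t(f²) − (P_t f)² ≥
2t Γ(P_t f)` for the Markov generator `Δ`), equivalently the classical **Bernstein gradient
estimate for the heat equation**: if `|f| ≤ C` then `2t ‖∇(e^{tΔ}f)(x)‖² ≤ C² − (e^{tΔ}f)(x)²`
(`two_mul_mul_sq_norm_fderiv_heatExtension_le`) — the gradient of a bounded caloric function is
small wherever the function is close to its extremal value (used for level sets of the speed near
its maximum in the De Giorgi programme of `Summits/NavierStokesRegularity`, route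
`LevelSetModeration`).

## Proof (Bessel's inequality in `L²(G_t(z) dz)`)

With `V = (e^{tΔ}f)(x) = ∫ G_t(z) f(x − z) dz` and, for `c ∈ E`,
`∂_c(e^{tΔ}f)(x) = −(2t)⁻¹ ∫ ⟪z, c⟫ G_t(z) f(x − z) dz` (`∇G_t(z) = −G_t(z) z/(2t)`), expand
`0 ≤ ∫ G_t(z) (f(x − z) − V − ⟪z, c⟫)² dz` using the Gaussian moments `∫ G_t = 1`,
`∫ ⟪z, c⟫ G_t = 0`, `∫ ⟪z, c⟫² G_t = 2t‖c‖²` (Stein's identity `integral_inner_mul_mul_heatKernel`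
and one more Gaussian integration by parts): `V² − 4t ∂_c(e^{tΔ}f)(x) − 2t‖c‖² ≤ e^{tΔ}(f²)(x)`
for every `c`; the choice `c = −∇(e^{tΔ}f)(x)` gives the claim (the functions `1` and
`⟪z, ·⟫/√(2t)` are orthonormal in `L²(G_t)`, so this is Bessel's inequality for `f(x − ·)`).

## References

* D. Bakry, I. Gentil, M. Ledoux, *Analysis and Geometry of Markov Diffusion Operators*,
  Springer 2014, Thm. 4.7.2 (local Poincaré inequalities; (ii) the reverse form). [cite: BakryGentilLedoux2014, Thm. 4.7.2]
* L. C. Evans, *Partial Differential Equations*, 2nd ed., §2.3.1 (heat kernel). [folklore]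
-/

open MeasureTheory Filter Topology Set InnerProductSpace Metric
open scoped Real RealInnerProductSpace

noncomputable section

namespace Literature.Analysis.UnboundedOperators

variable {E : Type*} [NormedAddCommGroup E] [InnerProductSpace ℝ E] [FiniteDimensional ℝ E]
  [MeasurableSpace E] [BorelSpace E]

/-! ### Gaussian moments of the heat kernel -/

/-- `‖z‖² G_t(z)` is integrable for `0 < t` (`s e^{-s/(8t)} ≤ 8t` and the Gaussian
`e^{-‖z‖²/(8t)}` is integrable). [folklore] -/
theorem integrable_norm_sq_mul_heatKernel {t : ℝ} (ht : 0 < t) :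
    Integrable (fun z : E => ‖z‖ ^ 2 * heatKernel t z) := by
  have hb : 0 < 1 / (8 * t) := by positivity
  set c : ℝ := (4 * π * t) ^ (-(Module.finrank ℝ E : ℝ) / 2) with hc
  have hc0 : 0 ≤ c := by positivity
  have hdom : ∀ z : E, ‖‖z‖ ^ 2 * heatKernel t z‖ ≤
      8 * t * c * Real.exp (-(1 / (8 * t)) * ‖z‖ ^ 2) := fun z => by
    rw [Real.norm_of_nonneg (mul_nonneg (sq_nonneg _) (heatKernel_pos ht z).le), heatKernel_eq]
    -- `s e^{-s/(8t)} ≤ 8t` with `s = ‖z‖²`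
    have hs : ‖z‖ ^ 2 * Real.exp (-(1 / (8 * t)) * ‖z‖ ^ 2) ≤ 8 * t := by
      have h1 : 1 / (8 * t) * ‖z‖ ^ 2 + 1 ≤ Real.exp (1 / (8 * t) * ‖z‖ ^ 2) :=
        Real.add_one_le_exp _
      have h2 : ‖z‖ ^ 2 ≤ 8 * t * Real.exp (1 / (8 * t) * ‖z‖ ^ 2) := by
        have h3 : 1 / (8 * t) * ‖z‖ ^ 2 ≤ Real.exp (1 / (8 * t) * ‖z‖ ^ 2) := by linarith
        calc ‖z‖ ^ 2 = 8 * t * (1 / (8 * t) * ‖z‖ ^ 2) := by field_simp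
          _ ≤ 8 * t * Real.exp (1 / (8 * t) * ‖z‖ ^ 2) :=
              mul_le_mul_of_nonneg_left h3 (by positivity)
      rw [neg_mul, Real.exp_neg]
      rw [← div_eq_mul_inv, div_le_iff₀ (Real.exp_pos _)]
      exact h2
    have hsplit : Real.exp (-(1 / (4 * t)) * ‖z‖ ^ 2) =
        Real.exp (-(1 / (8 * t)) * ‖z‖ ^ 2) * Real.exp (-(1 / (8 * t)) * ‖z‖ ^ 2) := by
      rw [← Real.exp_add]; congr 1; ring
    calc ‖z‖ ^ 2 * (c * Real.exp (-(1 / (4 * t)) * ‖z‖ ^ 2))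
        = c * (‖z‖ ^ 2 * Real.exp (-(1 / (8 * t)) * ‖z‖ ^ 2)) *
            Real.exp (-(1 / (8 * t)) * ‖z‖ ^ 2) := by rw [hsplit]; ring
      _ ≤ c * (8 * t) * Real.exp (-(1 / (8 * t)) * ‖z‖ ^ 2) := by gcongr
      _ = 8 * t * c * Real.exp (-(1 / (8 * t)) * ‖z‖ ^ 2) := by ring
  refine ((integrable_gaussian_of_pos (E := E) hb).const_mul (8 * t * c)).mono' ?_
    (Eventually.of_forall hdom)
  exact ((continuous_norm.pow 2).mul (continuous_heatKernel t)).aestronglyMeasurable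

/-- First moments vanish: `∫ ⟪z, v⟫ G_t(z) dz = 0` (`0 < t`; Stein's identity with `g ≡ 1`).
[folklore] -/
theorem integral_inner_mul_heatKernel_eq_zero {t : ℝ} (ht : 0 < t) (v : E) :
    ∫ z, ⟪z, v⟫ * heatKernel t z = 0 := by
  have h := integral_inner_mul_mul_heatKernel (E := E) ht (g := fun _ => (1 : ℝ)) contDiff_const
    (C₀ := 1) (C₁ := 0) (fun z => by simp) (fun z => by simp) v
  simpa using h

/-- Second moments: `∫ ⟪z, w⟫ ⟪z, v⟫ G_t(z) dz = 2t ⟪w, v⟫` (`0 < t`; Gaussian integration by parts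
with the linear function `⟪·, w⟫` against `∂ᵥ G_t = −G_t ⟪·, v⟫/(2t)`). [folklore] -/
theorem integral_inner_mul_inner_mul_heatKernel {t : ℝ} (ht : 0 < t) (w v : E) :
    ∫ z, ⟪z, w⟫ * ⟪z, v⟫ * heatKernel t z = 2 * t * ⟪w, v⟫ := by
  have hK := integrable_heatKernel_holds (E := E) ht
  set f : E → ℝ := fun z => innerSL ℝ w z with hf
  have hfz : ∀ z, f z = ⟪z, w⟫ := fun z => by
    rw [hf]; dsimp only; rw [innerSL_apply_apply, real_inner_comm]
  have hfd : ∀ z, fderiv ℝ f z = innerSL ℝ w := fun z => (innerSL ℝ w).fderiv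
  have hfdv : ∀ z, fderiv ℝ f z v = ⟪w, v⟫ := fun z => by rw [hfd, innerSL_apply_apply]
  have hGd : ∀ z, fderiv ℝ (heatKernel t) z v = -(heatKernel t z / (2 * t)) * ⟪z, v⟫ :=
    fun z => fderiv_heatKernel_apply_eq_mul_inner t z v
  -- integrability of the three products
  have i1 : Integrable fun z => fderiv ℝ f z v * heatKernel t z := by
    refine (hK.const_mul ⟪w, v⟫).congr (Eventually.of_forall fun z => ?_)
    simp only [hfdv]
  have i2 : Integrable fun z => f z * fderiv ℝ (heatKernel t) z v := by
    have hI := (integrable_norm_sq_mul_heatKernel (E := E) ht).const_mul (‖w‖ * ‖v‖ / (2 * t))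
    refine hI.mono' ?_ (Eventually.of_forall fun z => ?_)
    · have hc : Continuous fun z => f z * fderiv ℝ (heatKernel t) z v :=
        (innerSL ℝ w).continuous.mul
          ((continuous_fderiv_heatKernel t).clm_apply continuous_const)
      exact hc.aestronglyMeasurable
    · rw [hfz, hGd, norm_mul, norm_mul, norm_neg, Real.norm_eq_abs, Real.norm_eq_abs,
        Real.norm_eq_abs, abs_div, abs_of_pos (heatKernel_pos ht z),
        abs_of_pos (by positivity : (0 : ℝ) < 2 * t)]
      have h1 : |⟪z, w⟫| ≤ ‖z‖ * ‖w‖ := abs_real_inner_le_norm z w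
      have h2 : |⟪z, v⟫| ≤ ‖z‖ * ‖v‖ := abs_real_inner_le_norm z v
      have hG := (heatKernel_pos ht z).le
      calc |⟪z, w⟫| * (heatKernel t z / (2 * t) * |⟪z, v⟫|)
          ≤ (‖z‖ * ‖w‖) * (heatKernel t z / (2 * t) * (‖z‖ * ‖v‖)) := by
            gcongr
      _ = ‖w‖ * ‖v‖ / (2 * t) * (‖z‖ ^ 2 * heatKernel t z) := by ring
  have i3 : Integrable fun z => f z * heatKernel t z := by
    refine ((integrable_heatKernel_mul_norm (E := E) ht).const_mul ‖w‖).mono' ?_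
      (Eventually.of_forall fun z => ?_)
    · exact ((innerSL ℝ w).continuous.mul (continuous_heatKernel t)).aestronglyMeasurable
    · rw [hfz, norm_mul, Real.norm_eq_abs, Real.norm_of_nonneg (heatKernel_pos ht z).le]
      calc |⟪z, w⟫| * heatKernel t z ≤ (‖z‖ * ‖w‖) * heatKernel t z :=
            mul_le_mul_of_nonneg_right (abs_real_inner_le_norm z w) (heatKernel_pos ht z).le
        _ = ‖w‖ * (heatKernel t z * ‖z‖) := by ring
  have hibp := integral_mul_fderiv_eq_neg_fderiv_mul_of_integrable i1 i2 i3
    (fun z _ => (innerSL ℝ w).differentiableAt)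
    (fun z _ => (hasFDerivAt_heatKernel t z).differentiableAt)
  -- evaluate both sides
  have hl : ∫ z, f z * fderiv ℝ (heatKernel t) z v =
      -(1 / (2 * t)) * ∫ z, ⟪z, w⟫ * ⟪z, v⟫ * heatKernel t z := by
    rw [← integral_const_mul]
    refine integral_congr_ae (Eventually.of_forall fun z => ?_)
    dsimp only
    rw [hfz, hGd]
    ring
  have hr : ∫ z, fderiv ℝ f z v * heatKernel t z = ⟪w, v⟫ := by
    have : (fun z => fderiv ℝ f z v * heatKernel t z) = fun z => ⟪w, v⟫ * heatKernel t z :=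
      funext fun z => by rw [hfdv]
    rw [this, integral_const_mul, integral_heatKernel_eq_one_holds ht, mul_one]
  rw [hl, hr] at hibp
  have h2t : (2 * t) ≠ 0 := by positivity
  field_simp at hibp
  linarith

/-! ### The reverse Poincaré inequality -/

/-- The directional derivative of the caloric extension of bounded continuous data as a Gaussian
first moment: `∂_c(e^{tΔ}f)(x) = −(2t)⁻¹ ∫ ⟪z, c⟫ G_t(z) f(x − z) dz`. [folklore] -/
theorem fderiv_heatExtension_apply_eq_integral_inner {f : E → ℝ} (hf : Continuous f) {C : ℝ}
    (hC : ∀ z, ‖f z‖ ≤ C) {t : ℝ} (ht : 0 < t) (x c : E) :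
    fderiv ℝ (heatExtension f t) x c =
      -(1 / (2 * t)) * ∫ z, ⟪z, c⟫ * heatKernel t z * f (x - z) := by
  have hmem : MemLp f ⊤ volume := memLp_top_of_continuous_of_bound hf hC
  have hD := (hasFDerivAt_heatExtension (F := ℝ) hmem le_top ht x).fderiv
  -- integrability of the operator-valued integrand
  have hC0 : 0 ≤ C := (norm_nonneg _).trans (hC 0)
  have hΦ : Integrable (fun y => (fderiv ℝ (heatKernel t) (x - y)).smulRight (f y)) := by
    have hI : Integrable fun y => ‖fderiv ℝ (heatKernel (E := E) t) (x - y)‖ * C :=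
      ((integrable_norm_fderiv_heatKernel (E := E) ht).comp_sub_left x).mul_const C
    refine hI.mono' ?_ (Eventually.of_forall fun y => ?_)
    · have h1 : AEStronglyMeasurable (fun y => fderiv ℝ (heatKernel t) (x - y)) volume :=
        ((continuous_fderiv_heatKernel t).comp (continuous_const.sub continuous_id)).aestronglyMeasurable
      exact (ContinuousLinearMap.smulRightL ℝ E ℝ).aestronglyMeasurable_comp₂ h1 hmem.1
    · rw [ContinuousLinearMap.norm_smulRight_apply]
      exact mul_le_mul_of_nonneg_left (hC y) (norm_nonneg _)
  rw [hD, ContinuousLinearMap.integral_apply hΦ c]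
  simp only [ContinuousLinearMap.smulRight_apply, smul_eq_mul]
  have hsub := integral_sub_left_eq_self
    (fun z => fderiv ℝ (heatKernel t) z c * f (x - z)) volume x
  simp only [sub_sub_cancel] at hsub
  rw [hsub, ← integral_const_mul]
  refine integral_congr_ae (Eventually.of_forall fun z => ?_)
  dsimp only
  rw [fderiv_heatKernel_apply_eq_mul_inner]
  ring

/-- **Reverse Poincaré inequality of the heat semigroup / caloric Bernstein estimate.** For a
bounded continuous `f : E → ℝ`, `0 < t` and `x ∈ E`:
`(e^{tΔ}f)(x)² + 2t ‖∇(e^{tΔ}f)(x)‖² ≤ e^{tΔ}(f²)(x)` (Bakry–Gentil–Ledoux, Thm. 4.7.2 (ii),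
`ρ = 0`; Bessel's inequality for `f(x − ·)` against the orthonormal system `1, ⟪z, ·⟫/√(2t)` of
`L²(G_t(z) dz)`). [cite: BakryGentilLedoux2014, Thm. 4.7.2] -/
theorem sq_heatExtension_add_le_heatExtension_sq {f : E → ℝ} (hf : Continuous f) {C : ℝ}
    (hC : ∀ z, ‖f z‖ ≤ C) {t : ℝ} (ht : 0 < t) (x : E) :
    heatExtension f t x ^ 2 + 2 * t * ‖fderiv ℝ (heatExtension f t) x‖ ^ 2 ≤
      heatExtension (fun y => f y ^ 2) t x := by
  haveI : CompleteSpace E := FiniteDimensional.complete ℝ E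
  have hK := integrable_heatKernel_holds (E := E) ht
  have hK1 := integral_heatKernel_eq_one_holds (E := E) ht
  have hC0 : 0 ≤ C := (norm_nonneg _).trans (hC 0)
  have hfc : Continuous fun z => f (x - z) := hf.comp (continuous_const.sub continuous_id)
  have hfb : ∀ z, ‖f (x - z)‖ ≤ C := fun z => hC _
  -- the two caloric extensions as Gaussian integrals
  set V : ℝ := heatExtension f t x with hVdef
  have hV : V = ∫ z, heatKernel t z * f (x - z) := by
    rw [hVdef, heatExtension_apply]; rfl
  have hS : heatExtension (fun y => f y ^ 2) t x = ∫ z, heatKernel t z * f (x - z) ^ 2 := by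
    rw [heatExtension_apply]; rfl
  -- integrable pieces
  have iGa : Integrable fun z => heatKernel t z * f (x - z) :=
    (hK.bdd_mul hfc.aestronglyMeasurable (Eventually.of_forall hfb)).congr
      (Eventually.of_forall fun z => mul_comm _ _)
  have h2c : Continuous fun z => f (x - z) ^ 2 := hfc.pow 2
  have h2b : ∀ z, ‖f (x - z) ^ 2‖ ≤ C ^ 2 := fun z => by
    rw [norm_pow]; exact pow_le_pow_left₀ (norm_nonneg _) (hfb z) 2
  have iGa2 : Integrable fun z => heatKernel t z * f (x - z) ^ 2 :=
    (hK.bdd_mul h2c.aestronglyMeasurable (Eventually.of_forall h2b)).congr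
      (Eventually.of_forall fun z => mul_comm _ _)
  have iLG : ∀ c : E, Integrable fun z => ⟪z, c⟫ * heatKernel t z := fun c => by
    refine ((integrable_heatKernel_mul_norm (E := E) ht).const_mul ‖c‖).mono' ?_
      (Eventually.of_forall fun z => ?_)
    · exact ((continuous_id.inner continuous_const).mul (continuous_heatKernel t)).aestronglyMeasurable
    · rw [norm_mul, Real.norm_eq_abs, Real.norm_of_nonneg (heatKernel_pos ht z).le]
      calc |⟪z, c⟫| * heatKernel t z ≤ (‖z‖ * ‖c‖) * heatKernel t z :=
            mul_le_mul_of_nonneg_right (abs_real_inner_le_norm z c) (heatKernel_pos ht z).le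
        _ = ‖c‖ * (heatKernel t z * ‖z‖) := by ring
  have iLGa : ∀ c : E, Integrable fun z => ⟪z, c⟫ * heatKernel t z * f (x - z) := fun c =>
    ((iLG c).bdd_mul hfc.aestronglyMeasurable (Eventually.of_forall hfb)).congr
      (Eventually.of_forall fun z => mul_comm _ _)
  have iLLG : ∀ c : E, Integrable fun z => ⟪z, c⟫ * ⟪z, c⟫ * heatKernel t z := fun c => by
    refine ((integrable_norm_sq_mul_heatKernel (E := E) ht).const_mul (‖c‖ ^ 2)).mono' ?_
      (Eventually.of_forall fun z => ?_)
    · exact (((continuous_id.inner continuous_const).mul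
        (continuous_id.inner continuous_const)).mul (continuous_heatKernel t)).aestronglyMeasurable
    · rw [norm_mul, norm_mul, Real.norm_eq_abs, Real.norm_of_nonneg (heatKernel_pos ht z).le]
      have h1 : |⟪z, c⟫| ≤ ‖z‖ * ‖c‖ := abs_real_inner_le_norm z c
      have h0 : 0 ≤ |⟪z, c⟫| := abs_nonneg _
      calc |⟪z, c⟫| * |⟪z, c⟫| * heatKernel t z ≤ (‖z‖ * ‖c‖) * (‖z‖ * ‖c‖) * heatKernel t z := by
            gcongr
            exact (heatKernel_pos ht z).le
        _ = ‖c‖ ^ 2 * (‖z‖ ^ 2 * heatKernel t z) := by ring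
  -- the key one-parameter family of inequalities
  have key : ∀ c : E, V ^ 2 - 4 * t * fderiv ℝ (heatExtension f t) x c - 2 * t * ‖c‖ ^ 2 ≤
      heatExtension (fun y => f y ^ 2) t x := by
    intro c
    set W : ℝ := ∫ z, ⟪z, c⟫ * heatKernel t z * f (x - z) with hW
    have hDc : fderiv ℝ (heatExtension f t) x c = -(1 / (2 * t)) * W :=
      fderiv_heatExtension_apply_eq_integral_inner hf hC ht x c
    -- `0 ≤ ∫ G (a - V - ℓ)²`
    have hnn : 0 ≤ ∫ z, heatKernel t z * (f (x - z) - V - ⟪z, c⟫) ^ 2 :=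
      integral_nonneg fun z => mul_nonneg (heatKernel_pos ht z).le (sq_nonneg _)
    -- expansion of the integrand
    have hexp : ∀ z, heatKernel t z * (f (x - z) - V - ⟪z, c⟫) ^ 2 =
        (heatKernel t z * f (x - z) ^ 2 - 2 * V * (heatKernel t z * f (x - z))
          - 2 * (⟪z, c⟫ * heatKernel t z * f (x - z)))
        + (V ^ 2 * heatKernel t z + 2 * V * (⟪z, c⟫ * heatKernel t z)
          + ⟪z, c⟫ * ⟪z, c⟫ * heatKernel t z) := fun z => by ring
    have i12 : Integrable fun z =>
        heatKernel t z * f (x - z) ^ 2 - 2 * V * (heatKernel t z * f (x - z)) :=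
      iGa2.sub (iGa.const_mul _)
    have i3 : Integrable fun z => 2 * (⟪z, c⟫ * heatKernel t z * f (x - z)) :=
      (iLGa c).const_mul _
    have i123 : Integrable fun z =>
        heatKernel t z * f (x - z) ^ 2 - 2 * V * (heatKernel t z * f (x - z))
          - 2 * (⟪z, c⟫ * heatKernel t z * f (x - z)) := i12.sub i3
    have i45 : Integrable fun z => V ^ 2 * heatKernel t z + 2 * V * (⟪z, c⟫ * heatKernel t z) :=
      (hK.const_mul _).add ((iLG c).const_mul _)
    have i456 : Integrable fun z => V ^ 2 * heatKernel t z + 2 * V * (⟪z, c⟫ * heatKernel t z)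
          + ⟪z, c⟫ * ⟪z, c⟫ * heatKernel t z := i45.add (iLLG c)
    have hI1 : ∫ z, (heatKernel t z * f (x - z) ^ 2 - 2 * V * (heatKernel t z * f (x - z))
          - 2 * (⟪z, c⟫ * heatKernel t z * f (x - z))) =
        heatExtension (fun y => f y ^ 2) t x - 2 * V * V - 2 * W := by
      rw [integral_sub i12 i3, integral_sub iGa2 (iGa.const_mul _), integral_const_mul,
        integral_const_mul, ← hV, ← hS]
    have hI2 : ∫ z, (V ^ 2 * heatKernel t z + 2 * V * (⟪z, c⟫ * heatKernel t z)
          + ⟪z, c⟫ * ⟪z, c⟫ * heatKernel t z) = V ^ 2 + 2 * t * ‖c‖ ^ 2 := by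
      rw [integral_add i45 (iLLG c), integral_add (hK.const_mul _) ((iLG c).const_mul _),
        integral_const_mul, integral_const_mul, hK1, integral_inner_mul_heatKernel_eq_zero ht c,
        integral_inner_mul_inner_mul_heatKernel ht c c, real_inner_self_eq_norm_sq]
      ring
    have hint : ∫ z, heatKernel t z * (f (x - z) - V - ⟪z, c⟫) ^ 2 =
        (heatExtension (fun y => f y ^ 2) t x - 2 * V * V - 2 * W)
          + (V ^ 2 + 2 * t * ‖c‖ ^ 2) := by
      rw [integral_congr_ae (Eventually.of_forall hexp), ← hI1, ← hI2]
      exact integral_add i123 i456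
    rw [hint] at hnn
    have h4 : 4 * t * (-(1 / (2 * t)) * W) = -(2 * W) := by
      field_simp
      ring
    rw [hDc, h4]
    linarith
  -- choose `c = -∇(e^{tΔ}f)(x)`
  set L := fderiv ℝ (heatExtension f t) x with hL
  set g : E := (InnerProductSpace.toDual ℝ E).symm L with hg
  have hLg : L (-g) = -‖L‖ ^ 2 := by
    rw [map_neg, ← InnerProductSpace.toDual_symm_apply (x := g) (y := L), ← hg,
      real_inner_self_eq_norm_sq, hg, LinearIsometryEquiv.norm_map]
  have hng : ‖-g‖ ^ 2 = ‖L‖ ^ 2 := by rw [norm_neg, hg, LinearIsometryEquiv.norm_map]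
  have := key (-g)
  rw [hLg, hng] at this
  linarith

/-- **Bernstein's gradient estimate for the heat equation.** If `f : E → ℝ` is continuous with
`|f| ≤ C`, then for `0 < t` and every `x`: `2t ‖∇(e^{tΔ}f)(x)‖² ≤ C² − (e^{tΔ}f)(x)²` — near a
point where the bounded caloric function `e^{tΔ}f` is within `η` of `±C`, its gradient is at most
`√(Cη/t)`. [cite: BakryGentilLedoux2014, Thm. 4.7.2] -/
theorem two_mul_mul_sq_norm_fderiv_heatExtension_le {f : E → ℝ} (hf : Continuous f) {C : ℝ}
    (hC : ∀ z, ‖f z‖ ≤ C) {t : ℝ} (ht : 0 < t) (x : E) :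
    2 * t * ‖fderiv ℝ (heatExtension f t) x‖ ^ 2 ≤ C ^ 2 - heatExtension f t x ^ 2 := by
  have h := sq_heatExtension_add_le_heatExtension_sq hf hC ht x
  -- `e^{tΔ}(f²)(x) ≤ C²` since `∫ G_t = 1`
  have hK := integrable_heatKernel_holds (E := E) ht
  have hfc : Continuous fun z => f (x - z) ^ 2 := (hf.comp (continuous_const.sub continuous_id)).pow 2
  have hfb : ∀ z, ‖f (x - z) ^ 2‖ ≤ C ^ 2 := fun z => by
    rw [norm_pow]; exact pow_le_pow_left₀ (norm_nonneg _) (hC _) 2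
  have hi : Integrable fun z => heatKernel t z * f (x - z) ^ 2 :=
    (hK.bdd_mul hfc.aestronglyMeasurable (Eventually.of_forall hfb)).congr
      (Eventually.of_forall fun z => mul_comm _ _)
  have hle : ∀ z, heatKernel t z * f (x - z) ^ 2 ≤ C ^ 2 * heatKernel t z := fun z => by
    rw [mul_comm]
    refine mul_le_mul_of_nonneg_right ?_ (heatKernel_pos ht z).le
    have := hC (x - z)
    rw [Real.norm_eq_abs] at this
    nlinarith [abs_nonneg (f (x - z)), sq_abs (f (x - z))]
  have hS : heatExtension (fun y => f y ^ 2) t x ≤ C ^ 2 := by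
    have hS' : heatExtension (fun y => f y ^ 2) t x = ∫ z, heatKernel t z * f (x - z) ^ 2 := by
      rw [heatExtension_apply]; rfl
    rw [hS']
    calc ∫ z, heatKernel t z * f (x - z) ^ 2 ≤ ∫ z, C ^ 2 * heatKernel t z :=
          integral_mono hi (hK.const_mul _) hle
      _ = C ^ 2 := by rw [integral_const_mul, integral_heatKernel_eq_one_holds ht, mul_one]
  linarith

end Literature.Analysis.UnboundedOperators

end
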